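import Summits.CriticalPhenomena.SAWScalingLimit.Theorems.SAWTotalPositivityBoundaryTP2Strip4OddBridge
import HarnessLib

/-!
# Crux `BoundaryTP2` (stmt-CriticalPhenomena-7115), line `Sketch`: the even sector of the width-4 transfer
as real sequences (lead c6, bridge of the width-4 transfer, part 3)

Twin of `strip4_oddSector_exists` (…Strip4OddBridge): for a start-row pair `(r₁, r₂) = (r, 3 - r)` the sums
`a = K(r₁→0) + K(r₂→0)`, `b = K(r₁→1) + K(r₂→1)`, `p = PP(r₁;2;0→1) + PP(r₂;2;0→1)`, `q = PP(·;3;0→1) sum`,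
`r = PP(·;3;0→2) sum`, `t = PP(·;3;1→2) sum` of the twelve oriented real kernels of the 4-row strips obey the
6-dimensional EVEN recursion of `stub_strip4_evenBoxStep` (all coefficients non-negative), with the
single-column initial vectors of `stub_strip4_evenBoxBase03/12` (`strip4_evenSector_exists`).
-/

noncomputable section

namespace Summit.CriticalPhenomena.SAWScalingLimit.Theorems.BoundaryTP2

open Literature.Probability.LatticeModels Literature.Probability.RandomPlanarGeometry
open Summit.CriticalPhenomena.SAWScalingLimit.Theorems.EdgeOfPositivity.Negative
open scoped ENNReal

/-! ## The even sector as real sequences -/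

open Classical in
/-- **The even sector of the width-4 transfer as real sequences.** For `x ≥ 0` and a start-row pair
`(r₁, r₂)` with `r₂ = 3 - r₁`, there are real sequences `a b p q r t : ℕ → ℝ` obeying the (non-negative) even
recursion of `stub_strip4_evenBoxStep`, with the dictionary
`a n = Z((0,r₁),(n,0)) + Z((0,r₂),(n,0))`, `b n = Z((0,r₁),(n,1)) + Z((0,r₂),(n,1))` (real parts) and the
single-column initial values of `stub_strip4_base`:
for `(r₁,r₂) = (0,3)`: `(1+x³, x+x², x², x, x², x)`; for `(1,2)`: `(x+x², 1+x, x, x², 0, 0)`. [folklore] -/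
theorem strip4_evenSector_exists {x : ℝ} (hx0 : 0 ≤ x) (r₁ r₂ : ℤ) (hr : (r₁ = 0 ∧ r₂ = 3) ∨ (r₁ = 1 ∧ r₂ = 2)) :
    ∃ a b p q r t : ℕ → ℝ,
      ((r₁ = 0 → a 0 = 1 + x ^ 3 ∧ b 0 = x + x ^ 2 ∧ p 0 = x ^ 2 ∧ q 0 = x ∧ r 0 = x ^ 2 ∧ t 0 = x) ∧
       (r₁ = 1 → a 0 = x + x ^ 2 ∧ b 0 = 1 + x ∧ p 0 = x ∧ q 0 = x ^ 2 ∧ r 0 = 0 ∧ t 0 = 0)) ∧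
      (∀ L, a (L + 1) = (x + x ^ 4) * a L + (x ^ 2 + x ^ 3) * b L + x ^ 4 * p L + x ^ 5 * q L + x ^ 4 * r L + x ^ 5 * t L ∧
        b (L + 1) = (x ^ 2 + x ^ 3) * a L + (x + x ^ 2) * b L + x ^ 5 * r L + x ^ 4 * t L ∧
        p (L + 1) = x ^ 3 * a L + x ^ 2 * b L + x ^ 3 * p L + x ^ 4 * q L ∧
        q (L + 1) = x ^ 2 * a L + x ^ 3 * b L + x ^ 4 * p L + x ^ 3 * q L + x ^ 4 * r L ∧
        r (L + 1) = x ^ 3 * a L + x ^ 4 * q L + x ^ 3 * r L + x ^ 4 * t L ∧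
        t (L + 1) = x ^ 2 * a L + x ^ 4 * r L + x ^ 3 * t L) ∧
      (∀ n : ℕ, a n = (pathKernel (discreteDomainGraph (rectDomain n 3) 1) x (st 0 r₁) (st n 0)).toReal +
          (pathKernel (discreteDomainGraph (rectDomain n 3) 1) x (st 0 r₂) (st n 0)).toReal ∧
        b n = (pathKernel (discreteDomainGraph (rectDomain n 3) 1) x (st 0 r₁) (st n 1)).toReal +
          (pathKernel (discreteDomainGraph (rectDomain n 3) 1) x (st 0 r₂) (st n 1)).toReal) := by
  -- the oriented real kernels for a start row `ρ`
  set K : ℤ → ℤ → ℕ → ℝ := fun ρ s n =>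
    (pathKernel (discreteDomainGraph (rectDomain n 3) 1) x (st 0 ρ) (st n s)).toReal with hK
  set PP : ℤ → ℤ → ℤ → ℤ → ℕ → ℝ := fun ρ s u v n =>
    (∑' (γ : (discreteDomainGraph (rectDomain n 3) 1).Path (st 0 ρ) (st n s))
        (γ' : (discreteDomainGraph (rectDomain n 3) 1).Path (st n u) (st n v)),
      (if List.Disjoint γ.1.support γ'.1.support then
        ENNReal.ofReal (x ^ γ.1.length) * ENNReal.ofReal (x ^ γ'.1.length) else 0)).toReal with hPP
  have hid : ((0:ℤ) = 0 ∧ (1:ℤ) = 1 ∧ (2:ℤ) = 2 ∧ (3:ℤ) = 3) ∨ ((0:ℤ) = 3 ∧ (1:ℤ) = 2 ∧ (2:ℤ) = 1 ∧ (3:ℤ) = 0) :=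
    Or.inl ⟨rfl, rfl, rfl, rfl⟩
  have x2 : 0 ≤ x ^ 2 := pow_nonneg hx0 2
  have x3 : 0 ≤ x ^ 3 := pow_nonneg hx0 3
  have x4 : 0 ≤ x ^ 4 := pow_nonneg hx0 4
  have x5 : 0 ≤ x ^ 5 := pow_nonneg hx0 5
  -- the six real recursions (identity row labelling) for every start row `ρ ∈ [0,3]`
  have RC : ∀ ρ : ℤ, 0 ≤ ρ ∧ ρ ≤ 3 → ∀ n : ℕ,
      K ρ 0 (n + 1) = x * K ρ 0 n + x ^ 2 * K ρ 1 n + x ^ 3 * K ρ 2 n + x ^ 4 * K ρ 3 n +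
        x ^ 4 * PP ρ 2 0 1 n + x ^ 5 * PP ρ 3 0 1 n + x ^ 4 * PP ρ 3 0 2 n + x ^ 5 * PP ρ 3 1 2 n := by
    intro ρ hρ n
    have h := stub_strip4_recCorner n hx0 ρ hρ 0 1 2 3 hid
      (stub_strip4_interlaced n ρ hρ 0 1 2 (by norm_num) (by norm_num) (by norm_num) (by norm_num))
      (stub_strip4_interlaced n ρ hρ 0 1 3 (by norm_num) (by norm_num) (by norm_num) (by norm_num))
      (stub_strip4_interlaced n ρ hρ 0 2 3 (by norm_num) (by norm_num) (by norm_num) (by norm_num))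
      (stub_strip4_interlaced n ρ hρ 1 2 3 (by norm_num) (by norm_num) (by norm_num) (by norm_num))
    simp only [hK, hPP]
    exact strip4_toReal8 hx0 x2 x3 x4 x4 x5 x4 x5 (strip4_ne_top _ _ _ _) (strip4_ne_top _ _ _ _)
      (strip4_ne_top _ _ _ _) (strip4_ne_top _ _ _ _) (strip4_pair_ne_top _ _ _ _ _ _)
      (strip4_pair_ne_top _ _ _ _ _ _) (strip4_pair_ne_top _ _ _ _ _ _) (strip4_pair_ne_top _ _ _ _ _ _) h
  have RN : ∀ ρ : ℤ, 0 ≤ ρ ∧ ρ ≤ 3 → ∀ n : ℕ,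
      K ρ 1 (n + 1) = x ^ 2 * K ρ 0 n + x * K ρ 1 n + x ^ 2 * K ρ 2 n + x ^ 3 * K ρ 3 n +
        x ^ 5 * PP ρ 3 0 2 n + x ^ 4 * PP ρ 3 1 2 n := by
    intro ρ hρ n
    have h := stub_strip4_recNear n hx0 ρ hρ 0 1 2 3 hid
      (stub_strip4_interlaced n ρ hρ 0 2 3 (by norm_num) (by norm_num) (by norm_num) (by norm_num))
      (stub_strip4_interlaced n ρ hρ 1 2 3 (by norm_num) (by norm_num) (by norm_num) (by norm_num))
    simp only [hK, hPP]
    exact strip4_toReal6 x2 hx0 x2 x3 x5 x4 (strip4_ne_top _ _ _ _) (strip4_ne_top _ _ _ _)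
      (strip4_ne_top _ _ _ _) (strip4_ne_top _ _ _ _) (strip4_pair_ne_top _ _ _ _ _ _)
      (strip4_pair_ne_top _ _ _ _ _ _) h
  have RP1 : ∀ ρ : ℤ, 0 ≤ ρ ∧ ρ ≤ 3 → ∀ n : ℕ,
      PP ρ 2 0 1 (n + 1) = x ^ 2 * K ρ 2 n + x ^ 3 * K ρ 3 n + x ^ 3 * PP ρ 2 0 1 n +
        x ^ 4 * PP ρ 3 0 1 n := by
    intro ρ hρ n
    have h := stub_strip4_recPair201 n hx0 ρ hρ 0 1 2 3 hid
    simp only [hK, hPP]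
    exact strip4_toReal4 x2 x3 x3 x4 (strip4_ne_top _ _ _ _) (strip4_ne_top _ _ _ _)
      (strip4_pair_ne_top _ _ _ _ _ _) (strip4_pair_ne_top _ _ _ _ _ _) h
  have RP2 : ∀ ρ : ℤ, 0 ≤ ρ ∧ ρ ≤ 3 → ∀ n : ℕ,
      PP ρ 3 0 1 (n + 1) = x ^ 3 * K ρ 2 n + x ^ 2 * K ρ 3 n + x ^ 4 * PP ρ 2 0 1 n +
        x ^ 3 * PP ρ 3 0 1 n + x ^ 4 * PP ρ 3 0 2 n := by
    intro ρ hρ n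
    have h := stub_strip4_recPair301 n hx0 ρ hρ 0 1 2 3 hid
    simp only [hK, hPP]
    exact strip4_toReal5 x3 x2 x4 x3 x4 (strip4_ne_top _ _ _ _) (strip4_ne_top _ _ _ _)
      (strip4_pair_ne_top _ _ _ _ _ _) (strip4_pair_ne_top _ _ _ _ _ _) (strip4_pair_ne_top _ _ _ _ _ _) h
  have RP3 : ∀ ρ : ℤ, 0 ≤ ρ ∧ ρ ≤ 3 → ∀ n : ℕ,
      PP ρ 3 0 2 (n + 1) = x ^ 3 * K ρ 3 n + x ^ 4 * PP ρ 3 0 1 n + x ^ 3 * PP ρ 3 0 2 n +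
        x ^ 4 * PP ρ 3 1 2 n := by
    intro ρ hρ n
    have h := stub_strip4_recPair302 n hx0 ρ hρ 0 1 2 3 hid
    simp only [hK, hPP]
    exact strip4_toReal4 x3 x4 x3 x4 (strip4_ne_top _ _ _ _) (strip4_pair_ne_top _ _ _ _ _ _)
      (strip4_pair_ne_top _ _ _ _ _ _) (strip4_pair_ne_top _ _ _ _ _ _) h
  have RP4 : ∀ ρ : ℤ, 0 ≤ ρ ∧ ρ ≤ 3 → ∀ n : ℕ,
      PP ρ 3 1 2 (n + 1) = x ^ 2 * K ρ 3 n + x ^ 4 * PP ρ 3 0 2 n + x ^ 3 * PP ρ 3 1 2 n := by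
    intro ρ hρ n
    have h := stub_strip4_recPair312 n hx0 ρ hρ 0 1 2 3 hid
    simp only [hK, hPP]
    exact strip4_toReal3 x2 x4 x3 (strip4_ne_top _ _ _ _) (strip4_pair_ne_top _ _ _ _ _ _)
      (strip4_pair_ne_top _ _ _ _ _ _) h
  -- the reflection `j ↦ 3 - j` of the point kernels
  have KR : ∀ (ρ s : ℤ) (n : ℕ), K ρ s n = K (3 - ρ) (3 - s) n := by
    intro ρ s n
    simp only [hK]
    rw [(stub_rect_reflect n 3 x 0 ρ n s).2]
    norm_num
  -- the single-column initial values
  have BK : ∀ ρ : ℤ, 0 ≤ ρ ∧ ρ ≤ 3 → ∀ s : ℤ, 0 ≤ s ∧ s ≤ 3 → ∀ k : ℕ, (ρ - s).natAbs = k →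
      K ρ s 0 = x ^ k := by
    intro ρ hρ s hs k hk
    have h := congrArg ENNReal.toReal ((stub_strip4_base hx0 ρ hρ).1 s hs)
    rw [hk, ENNReal.toReal_ofReal (pow_nonneg hx0 _)] at h
    exact h
  have BP : ∀ ρ : ℤ, 0 ≤ ρ ∧ ρ ≤ 3 → ∀ s u v : ℤ, 0 ≤ u → u < v → v ≤ 3 → 0 ≤ s → s ≤ 3 →
      (s < u ∨ v < s) → ∀ k : ℕ, (ρ - s).natAbs + (v - u).natAbs = k →
      PP ρ s u v 0 = if (ρ < u ∧ s < u) ∨ (v < ρ ∧ v < s) then x ^ k else 0 := by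
    intro ρ hρ s u v hu huv hv hs0 hs3 hout k hk
    have h := congrArg ENNReal.toReal ((stub_strip4_base hx0 ρ hρ).2 s u v hu huv hv hs0 hs3 hout)
    rw [hk] at h
    refine h.trans ?_
    split_ifs
    · exact ENNReal.toReal_ofReal (pow_nonneg hx0 _)
    · exact ENNReal.toReal_zero
  -- the start rows
  have hr2 : r₂ = 3 - r₁ := by rcases hr with ⟨rfl, rfl⟩ | ⟨rfl, rfl⟩ <;> norm_num
  have hρ1 : 0 ≤ r₁ ∧ r₁ ≤ 3 := by rcases hr with ⟨rfl, -⟩ | ⟨rfl, -⟩ <;> norm_num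
  have hρ2 : 0 ≤ r₂ ∧ r₂ ≤ 3 := by rcases hr with ⟨-, rfl⟩ | ⟨-, rfl⟩ <;> norm_num
  have F1 : ∀ n, K r₁ 2 n = K r₂ 1 n := fun n => by rw [KR r₁ 2 n, hr2]; norm_num
  have F2 : ∀ n, K r₂ 2 n = K r₁ 1 n := fun n => by rw [KR r₂ 2 n, hr2]; norm_num
  have F3 : ∀ n, K r₁ 3 n = K r₂ 0 n := fun n => by rw [KR r₁ 3 n, hr2]; norm_num
  have F4 : ∀ n, K r₂ 3 n = K r₁ 0 n := fun n => by rw [KR r₂ 3 n, hr2]; norm_num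
  clear_value K PP
  refine ⟨fun n => K r₁ 0 n + K r₂ 0 n, fun n => K r₁ 1 n + K r₂ 1 n,
    fun n => PP r₁ 2 0 1 n + PP r₂ 2 0 1 n, fun n => PP r₁ 3 0 1 n + PP r₂ 3 0 1 n,
    fun n => PP r₁ 3 0 2 n + PP r₂ 3 0 2 n, fun n => PP r₂ 3 1 2 n + PP r₁ 3 1 2 n,
    ⟨?_, ?_⟩, fun L => ?_, fun n => ⟨by simp only [hK], by simp only [hK]⟩⟩
  · -- initial values for `(r₁, r₂) = (0, 3)`
    rintro rfl
    obtain rfl : r₂ = 3 := by rw [hr2]; norm_num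
    have h0 : (0:ℤ) ≤ 0 ∧ (0:ℤ) ≤ 3 := by norm_num
    have h1 : (0:ℤ) ≤ 1 ∧ (1:ℤ) ≤ 3 := by norm_num
    have h3 : (0:ℤ) ≤ 3 ∧ (3:ℤ) ≤ 3 := by norm_num
    refine ⟨?_, ?_, ?_, ?_, ?_, ?_⟩
    · show K 0 0 0 + K 3 0 0 = _
      rw [BK 0 h0 0 h0 0 (by decide), BK 3 h3 0 h0 3 (by decide)]; ring
    · show K 0 1 0 + K 3 1 0 = _
      rw [BK 0 h0 1 h1 1 (by decide), BK 3 h3 1 h1 2 (by decide)]; ring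
    · show PP 0 2 0 1 0 + PP 3 2 0 1 0 = _
      rw [BP 0 h0 2 0 1 le_rfl (by norm_num) (by norm_num) (by norm_num) (by norm_num) (Or.inr (by norm_num))
          3 (by decide),
        BP 3 h3 2 0 1 le_rfl (by norm_num) (by norm_num) (by norm_num) (by norm_num) (Or.inr (by norm_num))
          2 (by decide), if_neg (by norm_num), if_pos (by norm_num)]
      ring
    · show PP 0 3 0 1 0 + PP 3 3 0 1 0 = _
      rw [BP 0 h0 3 0 1 le_rfl (by norm_num) (by norm_num) (by norm_num) le_rfl (Or.inr (by norm_num))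
          4 (by decide),
        BP 3 h3 3 0 1 le_rfl (by norm_num) (by norm_num) (by norm_num) le_rfl (Or.inr (by norm_num))
          1 (by decide), if_neg (by norm_num), if_pos (by norm_num)]
      ring
    · show PP 0 3 0 2 0 + PP 3 3 0 2 0 = _
      rw [BP 0 h0 3 0 2 le_rfl (by norm_num) (by norm_num) (by norm_num) le_rfl (Or.inr (by norm_num))
          5 (by decide),
        BP 3 h3 3 0 2 le_rfl (by norm_num) (by norm_num) (by norm_num) le_rfl (Or.inr (by norm_num))
          2 (by decide), if_neg (by norm_num), if_pos (by norm_num)]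
      ring
    · show PP 3 3 1 2 0 + PP 0 3 1 2 0 = _
      rw [BP 3 h3 3 1 2 (by norm_num) (by norm_num) (by norm_num) (by norm_num) le_rfl (Or.inr (by norm_num))
          1 (by decide),
        BP 0 h0 3 1 2 (by norm_num) (by norm_num) (by norm_num) (by norm_num) le_rfl (Or.inr (by norm_num))
          4 (by decide), if_pos (by norm_num), if_neg (by norm_num)]
      ring
  · -- initial values for `(r₁, r₂) = (1, 2)`
    rintro rfl
    obtain rfl : r₂ = 2 := by rw [hr2]; norm_num
    have h0 : (0:ℤ) ≤ 0 ∧ (0:ℤ) ≤ 3 := by norm_num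
    have h1 : (0:ℤ) ≤ 1 ∧ (1:ℤ) ≤ 3 := by norm_num
    have h2 : (0:ℤ) ≤ 2 ∧ (2:ℤ) ≤ 3 := by norm_num
    refine ⟨?_, ?_, ?_, ?_, ?_, ?_⟩
    · show K 1 0 0 + K 2 0 0 = _
      rw [BK 1 h1 0 h0 1 (by decide), BK 2 h2 0 h0 2 (by decide)]; ring
    · show K 1 1 0 + K 2 1 0 = _
      rw [BK 1 h1 1 h1 0 (by decide), BK 2 h2 1 h1 1 (by decide)]; ring
    · show PP 1 2 0 1 0 + PP 2 2 0 1 0 = _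
      rw [BP 1 h1 2 0 1 le_rfl (by norm_num) (by norm_num) (by norm_num) (by norm_num) (Or.inr (by norm_num))
          2 (by decide),
        BP 2 h2 2 0 1 le_rfl (by norm_num) (by norm_num) (by norm_num) (by norm_num) (Or.inr (by norm_num))
          1 (by decide), if_neg (by norm_num), if_pos (by norm_num)]
      ring
    · show PP 1 3 0 1 0 + PP 2 3 0 1 0 = _
      rw [BP 1 h1 3 0 1 le_rfl (by norm_num) (by norm_num) (by norm_num) le_rfl (Or.inr (by norm_num))
          3 (by decide),
        BP 2 h2 3 0 1 le_rfl (by norm_num) (by norm_num) (by norm_num) le_rfl (Or.inr (by norm_num))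
          2 (by decide), if_neg (by norm_num), if_pos (by norm_num)]
      ring
    · show PP 1 3 0 2 0 + PP 2 3 0 2 0 = _
      rw [BP 1 h1 3 0 2 le_rfl (by norm_num) (by norm_num) (by norm_num) le_rfl (Or.inr (by norm_num))
          4 (by decide),
        BP 2 h2 3 0 2 le_rfl (by norm_num) (by norm_num) (by norm_num) le_rfl (Or.inr (by norm_num))
          3 (by decide), if_neg (by norm_num), if_neg (by norm_num)]
      ring
    · show PP 2 3 1 2 0 + PP 1 3 1 2 0 = _
      rw [BP 2 h2 3 1 2 (by norm_num) (by norm_num) (by norm_num) (by norm_num) le_rfl (Or.inr (by norm_num))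
          2 (by decide),
        BP 1 h1 3 1 2 (by norm_num) (by norm_num) (by norm_num) (by norm_num) le_rfl (Or.inr (by norm_num))
          3 (by decide), if_neg (by norm_num), if_neg (by norm_num)]
      ring
  · -- the even recursion
    have C1 := RC r₁ hρ1 L
    have C2 := RC r₂ hρ2 L
    have N1 := RN r₁ hρ1 L
    have N2 := RN r₂ hρ2 L
    have P1 := RP1 r₁ hρ1 L
    have P2 := RP1 r₂ hρ2 L
    have Q1 := RP2 r₁ hρ1 L
    have Q2 := RP2 r₂ hρ2 L
    have S1 := RP3 r₁ hρ1 L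
    have S2 := RP3 r₂ hρ2 L
    have T1 := RP4 r₁ hρ1 L
    have T2 := RP4 r₂ hρ2 L
    have f1 := F1 L
    have f2 := F2 L
    have f3 := F3 L
    have f4 := F4 L
    refine ⟨?_, ?_, ?_, ?_, ?_, ?_⟩
    · simp only [C1, C2, f1, f2, f3, f4]; ring
    · simp only [N1, N2, f1, f2, f3, f4]; ring
    · simp only [P1, P2, f1, f2, f3, f4]; ring
    · simp only [Q1, Q2, f1, f2, f3, f4]; ring
    · simp only [S1, S2, f3, f4]; ring
    · simp only [T1, T2, f3, f4]; ring

end Summit.CriticalPhenomena.SAWScalingLimit.Theorems.BoundaryTP2
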